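import Summits.CriticalPhenomena.PercolationContinuityZ3.Theorems.PercNearOneGluingAdditiveGluingTiedRaiseMoves
import HarnessLib

/-!
# Crux `PercNearOneGluing.AdditiveGluing` (stmt-CriticalPhenomena-4576): the pivotal rate of a pair as the probability of an EVENT

Support file (`--supports stmt-CriticalPhenomena-4576`, lead prim-png-lead-4576).  No definitions, no named facts, no sorries.

For a pair `e = s(a₁,a₃)` (`a₁ ≠ a₃`) and any vertices `x, b`:
  `(1 − w e)·(μ_{w[e↦1]}(x↔b) − μ_{w[e↦0]}(x↔b)) = μ_w( (x↔b)ᶜ ∩ (x↔a₁ ∪ x↔a₃) ∩ (a₁↔b ∪ a₃↔b) )`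
— the gain from gluing the pair is the probability that the pair is PIVOTAL for `x ↔ b` (Russo's formula in finite form).  This turns the
rate statements of the registered kernel stubs `stub_tiedRaiseThreeInf_pl` / `stub_phiTiedRaiseThree_pl` into statements about five-point
connection patterns (the format of the Kozma–Nitzan / BHK exchange arguments).  [cite: KozmaNitzan2024, Lemma 4 / eq. (8) (p. 9)]
-/

namespace Summit.CriticalPhenomena.PercolationContinuityZ3.Theorems

open MeasureTheory Set Literature.Probability.LatticeModels Literature.Probability.Percolation

noncomputable section
open Classical

variable {n : ℕ}

/-- After gluing `{a₁,a₃}`, `x ↔ b` holds iff `x ↔ b` already, or `x` reaches the pair and the pair reaches `b` (as an event identity). [folklore] -/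
theorem tiedRaise_glue_openConn_eq (a₁ a₃ x b : Fin n) :
    {ω : BondConfig (Fin n) | (ω ∪ {e | (∀ z ∈ e, z ∈ ({a₁, a₃} : Finset (Fin n))) ∧ ¬ e.IsDiag}) ∈
        (openConn x b : Set (BondConfig (Fin n)))} =
      openConn x b ∪ (openConn x a₁ ∪ openConn x a₃) ∩ (openConn a₁ b ∪ openConn a₃ b) := by
  ext ω
  rw [Set.mem_setOf_eq, fullTie_glueReach_pair]
  simp only [Set.mem_union, Set.mem_inter_iff]

/-- **The glue gain is the probability of the pivotal event**:
`μ_{w[e↦1]}(x↔b) − μ_w(x↔b) = μ_w((x↔b)ᶜ ∩ (x↔a₁ ∪ x↔a₃) ∩ (a₁↔b ∪ a₃↔b))`, `e = s(a₁,a₃)`. [cite: KozmaNitzan2024, eq. (8) (p. 9)] -/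
theorem tiedRaise_glueGain_eq_event (w : Sym2 (Fin n) → unitInterval) {a₁ a₃ : Fin n} (h : a₁ ≠ a₃) (x b : Fin n) :
    (prodBernoulli (Function.update w s(a₁, a₃) 1)).real (openConn x b) - (prodBernoulli w).real (openConn x b) =
      (prodBernoulli w).real ((openConn x b)ᶜ ∩ ((openConn x a₁ ∪ openConn x a₃) ∩ (openConn a₁ b ∪ openConn a₃ b)) :
        Set (BondConfig (Fin n))) := by
  have hm : ∀ s : Set (BondConfig (Fin n)), MeasurableSet s := fun _ => MeasurableSet.of_discrete
  rw [fullTie_real_update_one w h, tiedRaise_glue_openConn_eq]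
  set Xb : Set (BondConfig (Fin n)) := openConn x b with hXb
  set G : Set (BondConfig (Fin n)) := (openConn x a₁ ∪ openConn x a₃) ∩ (openConn a₁ b ∪ openConn a₃ b) with hG
  have hsplit := measureReal_inter_add_sdiff (μ := prodBernoulli w) (s := Xb ∪ G) (hm Xb)
  have h1 : (Xb ∪ G) ∩ Xb = Xb := by
    ext ω; simp only [Set.mem_inter_iff, Set.mem_union]; tauto
  have h2 : (Xb ∪ G) \ Xb = Xbᶜ ∩ G := by
    ext ω; simp only [Set.mem_sdiff, Set.mem_union, Set.mem_inter_iff, Set.mem_compl_iff]; tauto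
  rw [h1, h2] at hsplit
  linarith

/-- **The pivotal rate as an event probability**: `(1 − w e)·g_x(e) = μ_w(e pivotal for x↔b)`, `e = s(a₁,a₃)`,
`g_x(e) = μ_{w[e↦1]}(x↔b) − μ_{w[e↦0]}(x↔b)`. [cite: KozmaNitzan2024, eq. (8) (p. 9)] -/
theorem tiedRaise_rate_eq_event (w : Sym2 (Fin n) → unitInterval) {a₁ a₃ : Fin n} (h : a₁ ≠ a₃) (x b : Fin n) :
    (1 - (w s(a₁, a₃) : ℝ)) *
        ((prodBernoulli (Function.update w s(a₁, a₃) 1)).real (openConn x b) -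
          (prodBernoulli (Function.update w s(a₁, a₃) 0)).real (openConn x b)) =
      (prodBernoulli w).real ((openConn x b)ᶜ ∩ ((openConn x a₁ ∪ openConn x a₃) ∩ (openConn a₁ b ∪ openConn a₃ b)) :
        Set (BondConfig (Fin n))) := by
  rw [← tiedRaise_gain_eq w s(a₁, a₃) (openConn x b)]
  exact tiedRaise_glueGain_eq_event w h x b

/-- At weight `w e = 0` the rate itself is the pivotal probability: `g_x(e) = μ_{w}(e pivotal for x↔b)` when `w s(a₁,a₃) = 0`. [folklore] -/
theorem tiedRaise_rate_eq_event_of_zero (w : Sym2 (Fin n) → unitInterval) {a₁ a₃ : Fin n} (h : a₁ ≠ a₃) (x b : Fin n)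
    (h0 : w s(a₁, a₃) = 0) :
    (prodBernoulli (Function.update w s(a₁, a₃) 1)).real (openConn x b) -
        (prodBernoulli (Function.update w s(a₁, a₃) 0)).real (openConn x b) =
      (prodBernoulli w).real ((openConn x b)ᶜ ∩ ((openConn x a₁ ∪ openConn x a₃) ∩ (openConn a₁ b ∪ openConn a₃ b)) :
        Set (BondConfig (Fin n))) := by
  have h1 := tiedRaise_rate_eq_event w h x b
  rw [h0] at h1
  simpa using h1

end

end Summit.CriticalPhenomena.PercolationContinuityZ3.Theorems
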